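import Literature.NumberTheory.Transcendental.ExpVarietiesDimension
import Literature.ModelTheory.Zilber.EACPeriodicModels
import Literature.ModelTheory.Zilber.EACDensityQuestion
import HarnessLib

/-!
# The fibration principle: generic-point facts

Zilber's Exponential-Algebraic Closedness, case ladder (host summit Schanuel, cell `pub-schanuel`,
seat 2, gen 5).  For a prime ideal `P ⊆ ℂ[X_σ]`, `σ = Fin (d+1) ⊕ Fin (d+1)`, with `Z(P)` meeting the
torus, let `ξ` be the generic point (tree: `genericPt P`, in the function field `K = ℂ(Z(P))`) and
`s̄ = ξ ∘ ι` its "small" coordinates (`ι = Sum.map castSucc castSucc`, i.e. all but `x_last, y_last`),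
which are also the non-constant coordinates of `[Δ_d] ξ` (`Δ_d = dropLastMat d`).  We read the
hypothesis `dim cl[Δ_d](Z(P) ∩ Gⁿ) = d` at the generic point:

* `card_le_of_algebraicIndependent_small`: any algebraically independent family of small coordinate
  functions has at most `d` members (tree: `le_zariskiDim_image_matrixAct'`);
* `exists_algebraicIndependent_small`: there are `d` algebraically independent small coordinate
  functions (a transcendence basis of `ℂ[[Δ_d] ξ]` inside its generators);
* `isAlgebraic_functionField_adjoin`: `K` is algebraic over `ℂ[ξ]` (fraction field);
* `trdeg_functionField_eq`: `trdeg_ℂ K = d + 1` when `dim Z(P) = d + 1`;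
* `exists_expPoint_small_of_unprojectedDense`: Zariski density of the exponential points of
  `cl[Δ_d](Z(P) ∩ Gⁿ)` (`UnprojectedDense`) produces, for every `c ∈ ℂ[X_τ]` with `c(s̄) ≠ 0`, an
  exponential small point `p` of `Z(P₁)` (`P₁ = ker (aeval s̄)`) with `c(p) ≠ 0`.

Honest framing: bookkeeping for `ZilberEacFibration.lean`; nothing about `EC(3,2)` (OPEN) or
Schanuel's conjecture is asserted here.
-/

noncomputable section

open MvPolynomial
open Literature.NumberTheory.Transcendental Literature.ModelTheory.Zilber

set_option linter.dupNamespace false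

namespace Summit.Schanuel.Schanuel.Theorems

variable {d : ℕ}

/-! ## The small coordinates of `[Δ_d] z` -/

section Small

variable {K : Type*} [Field K]

/-- `[Δ_d] z` agrees with `z` on every small coordinate `ι t`. [folklore] -/
theorem matrixAct_dropLastMat_comp_small (z : Fin (d + 1) ⊕ Fin (d + 1) → K) (t : Fin d ⊕ Fin d) :
    matrixAct (dropLastMat d) z (Sum.map Fin.castSucc Fin.castSucc t) =
      z (Sum.map Fin.castSucc Fin.castSucc t) := by
  rcases t with i | i
  · rw [Sum.map_inl, matrixAct_dropLastMat_inl, if_neg (Fin.castSucc_ne_last i)]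
  · rw [Sum.map_inr, matrixAct_dropLastMat_inr, if_neg (Fin.castSucc_ne_last i)]

/-- `x_last ([Δ_d] z) = 0`. [folklore] -/
theorem matrixAct_dropLastMat_inl_last (z : Fin (d + 1) ⊕ Fin (d + 1) → K) :
    matrixAct (dropLastMat d) z (Sum.inl (Fin.last d)) = 0 := by
  rw [matrixAct_dropLastMat_inl, if_pos rfl]

/-- `y_last ([Δ_d] z) = 1`. [folklore] -/
theorem matrixAct_dropLastMat_inr_last (z : Fin (d + 1) ⊕ Fin (d + 1) → K) :
    matrixAct (dropLastMat d) z (Sum.inr (Fin.last d)) = 1 := by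
  rw [matrixAct_dropLastMat_inr, if_pos rfl]

/-- Evaluating a small polynomial (pushed to `ℂ[X_σ]` by `rename ι`) at `[Δ_d] z` is evaluating it at
the small coordinates of `z`. [folklore] -/
theorem aeval_matrixAct_rename_small {F : Type*} [Field F] [Algebra F K]
    (z : Fin (d + 1) ⊕ Fin (d + 1) → K) (f : MvPolynomial (Fin d ⊕ Fin d) F) :
    aeval (matrixAct (dropLastMat d) z) (rename (Sum.map Fin.castSucc Fin.castSucc) f) =
      aeval (fun t => z (Sum.map Fin.castSucc Fin.castSucc t)) f := by
  have h : (matrixAct (dropLastMat d) z ∘ Sum.map Fin.castSucc Fin.castSucc) =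
      fun t => z (Sum.map Fin.castSucc Fin.castSucc t) :=
    funext (matrixAct_dropLastMat_comp_small z)
  rw [aeval_rename, h]

end Small

/-! ## Reading `dim cl[Δ_d] V = d` at the generic point -/

section Generic

variable (P : Ideal (MvPolynomial (Fin (d + 1) ⊕ Fin (d + 1)) ℂ)) [P.IsPrime]

/-- **Upper bound**: an algebraically independent family of small coordinate functions of the
generic point has at most `dim cl[Δ_d](Z(P) ∩ Gⁿ) = d` members. [folklore] -/
theorem card_le_of_algebraicIndependent_small
    (hne : (zeroLocus ℂ P ∩ torusLocus ℂ (d + 1)).Nonempty)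
    (hfib : zariskiDim ℂ (matrixAct (dropLastMat d) '' (zeroLocus ℂ P ∩ torusLocus ℂ (d + 1))) = d)
    {κ : Type*} [Fintype κ] (c : κ → Fin d ⊕ Fin d)
    (h : AlgebraicIndependent ℂ fun k => genericPt P (Sum.map Fin.castSucc Fin.castSucc (c k))) :
    Fintype.card κ ≤ d := by
  classical
  set e := Fintype.equivFin κ
  have h' : AlgebraicIndependent ℂ fun k : Fin (Fintype.card κ) =>
      aeval (matrixAct (dropLastMat d) (genericPt P))
        (X (Sum.map Fin.castSucc Fin.castSucc (c (e.symm k))) :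
          MvPolynomial (Fin (d + 1) ⊕ Fin (d + 1)) ℂ) := by
    have := h.comp e.symm e.symm.injective
    refine (algebraicIndependent_equiv' (Equiv.refl _) ?_).1 this
    funext k
    simp only [Function.comp_apply, Equiv.coe_refl, id_eq, aeval_X,
      matrixAct_dropLastMat_comp_small]
  have hle := le_zariskiDim_image_matrixAct' P (isGenericPt_genericPt P) hne (dropLastMat d) _ h'
  rw [hfib] at hle
  exact_mod_cast hle

/-- **Lower bound**: there are `d` algebraically independent small coordinate functions of the
generic point (a transcendence basis of `ℂ[[Δ_d] ξ]` chosen among its generators, none of which can be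
the constant coordinates `0`, `1`). [folklore] -/
theorem exists_algebraicIndependent_small
    (hne : (zeroLocus ℂ P ∩ torusLocus ℂ (d + 1)).Nonempty)
    (hfib : zariskiDim ℂ (matrixAct (dropLastMat d) '' (zeroLocus ℂ P ∩ torusLocus ℂ (d + 1))) = d) :
    ∃ b : Fin d → zeroLocusFunctionField P, AlgebraicIndependent ℂ b ∧
      ∀ k, ∃ t : Fin d ⊕ Fin d, b k = genericPt P (Sum.map Fin.castSucc Fin.castSucc t) := by
  classical
  set ξ := genericPt P with hξdef
  set y := matrixAct (dropLastMat d) ξ with hy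
  set φ : MvPolynomial (Fin (d + 1) ⊕ Fin (d + 1)) ℂ →ₐ[ℂ] zeroLocusFunctionField P := aeval y
    with hφ
  set A : Subalgebra ℂ (zeroLocusFunctionField P) := φ.range with hA
  -- `toNat (trdeg A) = d`, and `trdeg A` is finite
  have hdimA := zariskiDim_image_matrixAct_eq P (isGenericPt_genericPt P) hne (dropLastMat d)
  rw [hfib] at hdimA
  have hnat : Cardinal.toNat (Algebra.trdeg ℂ A) = d := by
    have := hdimA.symm
    exact_mod_cast this
  haveI : Algebra.FiniteType ℂ A :=
    Algebra.FiniteType.of_surjective φ.rangeRestrict (AlgHom.rangeRestrict_surjective φ)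
  have hfin : Algebra.trdeg ℂ A < Cardinal.aleph0 := trdeg_lt_aleph0
  have htr : Algebra.trdeg ℂ A = d := by
    rw [← Cardinal.cast_toNat_of_lt_aleph0 hfin, hnat]
  -- generators of `A`
  let gen : Fin (d + 1) ⊕ Fin (d + 1) → A := fun j => ⟨y j, ⟨X j, aeval_X _ _⟩⟩
  have hgen : Set.range gen = φ.rangeRestrict '' Set.range (X : _ → MvPolynomial _ ℂ) := by
    rw [← Set.range_comp]
    congr 1
    funext j
    exact Subtype.ext (by simp [gen, hφ])
  have htop : Algebra.adjoin ℂ (Set.range gen) = ⊤ := by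
    rw [hgen, Algebra.adjoin_image, MvPolynomial.adjoin_range_X, Algebra.map_top,
      AlgHom.range_eq_top]
    exact AlgHom.rangeRestrict_surjective φ
  haveI : Algebra.IsAlgebraic (Algebra.adjoin ℂ (Set.range gen)) A := by
    rw [htop]
    exact ⟨fun a => isAlgebraic_algebraMap (⟨a, Algebra.mem_top⟩ : (⊤ : Subalgebra ℂ A))⟩
  haveI : FaithfulSMul ℂ A := (faithfulSMul_iff_algebraMap_injective ℂ A).2 (algebraMap ℂ A).injective
  obtain ⟨t, htsub, htb⟩ := exists_isTranscendenceBasis_subset (R := ℂ) (A := A) (Set.range gen)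
  have hcard : Cardinal.mk t = d := by rw [htb.cardinalMk_eq_trdeg, htr]
  obtain ⟨e⟩ := Cardinal.mk_eq_nat_iff.1 hcard
  -- the basis, pushed into `K`
  let b₀ : Fin d → A := fun k => ((e.symm k : t) : A)
  have hb₀ : AlgebraicIndependent ℂ b₀ := htb.1.comp e.symm e.symm.injective
  refine ⟨fun k => (b₀ k : zeroLocusFunctionField P), hb₀.map' (f := A.val) Subtype.val_injective,
    fun k => ?_⟩
  -- each basis element is a generator `y j`, and `j` is a small index
  obtain ⟨j, hj⟩ : ((e.symm k : t) : A) ∈ Set.range gen := htsub (e.symm k).2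
  have hbk : (b₀ k : zeroLocusFunctionField P) = y j := by
    change (((e.symm k : t) : A) : zeroLocusFunctionField P) = y j
    rw [← hj]
  have htrans : Transcendental ℂ (b₀ k : zeroLocusFunctionField P) :=
    (hb₀.map' (f := A.val) Subtype.val_injective).transcendental k
  rcases j with i | i
  · rcases Fin.eq_castSucc_or_eq_last i with ⟨i', rfl⟩ | rfl
    · refine ⟨Sum.inl i', ?_⟩
      change (b₀ k : zeroLocusFunctionField P) = _
      rw [hbk, hy, Sum.map_inl, matrixAct_dropLastMat_inl, if_neg (Fin.castSucc_ne_last i')]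
    · exfalso
      rw [hbk, hy, matrixAct_dropLastMat_inl_last] at htrans
      exact htrans (isAlgebraic_zero)
  · rcases Fin.eq_castSucc_or_eq_last i with ⟨i', rfl⟩ | rfl
    · refine ⟨Sum.inr i', ?_⟩
      change (b₀ k : zeroLocusFunctionField P) = _
      rw [hbk, hy, Sum.map_inr, matrixAct_dropLastMat_inr, if_neg (Fin.castSucc_ne_last i')]
    · exfalso
      rw [hbk, hy, matrixAct_dropLastMat_inr_last] at htrans
      exact htrans (isAlgebraic_one)

omit [P.IsPrime] in
/-- **The function field is algebraic over `ℂ[ξ]`** (it is its fraction field). [folklore] -/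
theorem isAlgebraic_functionField_adjoin [P.IsPrime] :
    Algebra.IsAlgebraic (Algebra.adjoin ℂ (Set.range (genericPt P))) (zeroLocusFunctionField P) := by
  haveI : IsDomain (zeroLocusCoordRing P) := Ideal.Quotient.isDomain P
  set A₀ := Algebra.adjoin ℂ (Set.range (genericPt P)) with hA₀
  have halgQ : Algebra.IsAlgebraic (zeroLocusCoordRing P) (zeroLocusFunctionField P) :=
    IsLocalization.isAlgebraic (zeroLocusFunctionField P) (nonZeroDivisors (zeroLocusCoordRing P))
  have hmem : ∀ q : zeroLocusCoordRing P,
      algebraMap (zeroLocusCoordRing P) (zeroLocusFunctionField P) q ∈ A₀ := by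
    intro q
    obtain ⟨a, rfl⟩ := Ideal.Quotient.mk_surjective q
    rw [← aeval_genericPt, hA₀, Algebra.adjoin_range_eq_range_aeval]
    exact ⟨a, rfl⟩
  let φ : zeroLocusCoordRing P →+* A₀ :=
    (algebraMap (zeroLocusCoordRing P) (zeroLocusFunctionField P)).codRestrict
      A₀.toSubring.toSubsemiring hmem
  have hφinj : Function.Injective φ := by
    intro q₁ q₂ h
    have := congrArg (fun a : A₀ => (a : zeroLocusFunctionField P)) h
    exact IsFractionRing.injective (zeroLocusCoordRing P) (zeroLocusFunctionField P) this
  have hcomp : (algebraMap A₀ (zeroLocusFunctionField P)).comp φ =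
      (RingHom.id _).comp (algebraMap (zeroLocusCoordRing P) (zeroLocusFunctionField P)) :=
    RingHom.ext fun q => rfl
  exact ⟨fun k => (halgQ.isAlgebraic k).ringHom_of_comp_eq φ (RingHom.id _) hφinj hcomp⟩

/-- **`trdeg_ℂ ℂ(Z(P)) = d + 1`** when `dim Z(P) = d + 1`. [folklore] -/
theorem trdeg_functionField_eq (hdim : zariskiDim ℂ (zeroLocus ℂ P) = (d + 1 : ℕ)) :
    Algebra.trdeg ℂ (zeroLocusFunctionField P) = Fintype.card (Fin d) + 1 := by
  rw [zariskiDim_zeroLocus_eq_trdeg_zeroLocusFunctionField P] at hdim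
  have hnat : Cardinal.toNat (Algebra.trdeg ℂ (zeroLocusFunctionField P)) = d + 1 := by
    exact_mod_cast hdim
  rw [Cardinal.toNat_eq_iff (Nat.succ_ne_zero d)] at hnat
  rw [hnat, Fintype.card_fin]
  norm_cast

/-! ## Exponential small points from `UnprojectedDense` -/

/-- **Density supplies generic exponential small points.**  If the exponential points of
`V' = cl[Δ_d](Z(P) ∩ Gⁿ)` are Zariski dense (`UnprojectedDense V'`), then for every small polynomial
`c` not killed at the generic point there is a small point `p = (x', e^{x'})` of `Z(P₁)`
(`P₁ = ker (aeval s̄)`, i.e. every small polynomial killed at the generic point vanishes at `p`) with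
`c(p) ≠ 0`. [folklore] -/
theorem exists_expPoint_small_of_unprojectedDense
    (hne : (zeroLocus ℂ P ∩ torusLocus ℂ (d + 1)).Nonempty)
    (hdense : UnprojectedDense (zeroLocus ℂ (vanishingIdeal ℂ
      (matrixAct (dropLastMat d) '' (zeroLocus ℂ P ∩ torusLocus ℂ (d + 1))))))
    (c : MvPolynomial (Fin d ⊕ Fin d) ℂ)
    (hc : aeval (fun t => genericPt P (Sum.map Fin.castSucc Fin.castSucc t)) c ≠ 0) :
    ∃ p : Fin d ⊕ Fin d → ℂ,
      (∀ i, p (Sum.inr i) =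
        Literature.ModelTheory.ExponentialFields.ExponentialRing.exp (p (Sum.inl i))) ∧
      (∀ a : MvPolynomial (Fin d ⊕ Fin d) ℂ,
        aeval (fun t => genericPt P (Sum.map Fin.castSucc Fin.castSucc t)) a = 0 → aeval p a = 0) ∧
      aeval p c ≠ 0 := by
  set S := matrixAct (dropLastMat d) '' (zeroLocus ℂ P ∩ torusLocus ℂ (d + 1)) with hS
  have hker := vanishingIdeal_image_matrixAct_eq_ker P (isGenericPt_genericPt P) hne (dropLastMat d)
  -- membership in `I(S)` of a pushed small polynomial, read at the generic point
  have hmemS : ∀ a : MvPolynomial (Fin d ⊕ Fin d) ℂ,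
      rename (Sum.map Fin.castSucc Fin.castSucc) a ∈ vanishingIdeal ℂ S ↔
        aeval (fun t => genericPt P (Sum.map Fin.castSucc Fin.castSucc t)) a = 0 := by
    intro a
    rw [hS, hker, RingHom.mem_ker]
    change aeval (matrixAct (dropLastMat d) (genericPt P))
      (rename (Sum.map Fin.castSucc Fin.castSucc) a) = 0 ↔ _
    rw [aeval_matrixAct_rename_small]
  -- `I(cl S) = I(S)`
  have hII : vanishingIdeal ℂ (zeroLocus ℂ (vanishingIdeal ℂ S)) = vanishingIdeal ℂ S := by
    refine le_antisymm (vanishingIdeal_anti_mono (le_zeroLocus_iff_le_vanishingIdeal.2 le_rfl)) ?_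
    exact le_vanishingIdeal_zeroLocus _
  -- `rename ι c ∉ I(cl S) = I(cl S ∩ Γ)`
  have hc' : rename (Sum.map Fin.castSucc Fin.castSucc) c ∉
      vanishingIdeal ℂ (zeroLocus ℂ (vanishingIdeal ℂ S) ∩ expGraph ℂ (d + 1)) := by
    rw [hdense, hII, hmemS]
    exact hc
  rw [mem_vanishingIdeal_iff] at hc'
  push Not at hc'
  obtain ⟨z, ⟨hzV, hzΓ⟩, hzc⟩ := hc'
  refine ⟨fun t => z (Sum.map Fin.castSucc Fin.castSucc t), fun i => ?_, fun a ha => ?_, ?_⟩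
  · have := (mem_expGraph_iff.1 hzΓ) (Fin.castSucc i)
    simpa only [Sum.map_inr, Sum.map_inl] using this
  · have hmem : rename (Sum.map Fin.castSucc Fin.castSucc) a ∈ vanishingIdeal ℂ S := (hmemS a).2 ha
    have := (mem_zeroLocus_iff.1 hzV) _ hmem
    rwa [aeval_rename] at this
  · rwa [aeval_rename] at hzc

end Generic

end Summit.Schanuel.Schanuel.Theorems
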